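import Mathlib.Topology.MetricSpace.Pseudo.Lemmas
import Mathlib.Data.List.Forall2
import Mathlib.Order.Fin.Basic
import HarnessLib

/-!
# Weak and separated vertex traversals of a spherical shell by a list of points

The DISCRETE shadow, on the vertex sequence of a polyline, of Aizenman–Burchard's event "the shell
`D(x; r, R)` is traversed by `k` separate segments of the curve" (AB99 §1.b (1.3);
`Curve.HasTraversals` in `CurveTortuosity.lean`). Everything is written out explicitly in the
statements (this file introduces no definitions):

* WEAK VERTEX TRAVERSALS of `D(x; r, R)` by the list `l` of points of a pseudo-metric space:
  `∃ ι κ : Fin k → Fin l.length`, `ι m ≤ κ m`, the points `l.get (ι m)`, `l.get (κ m)` lie on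
  opposite sides of the shell — one in the closed ball `B̄(x, r)`, the other at distance `≥ R` — and
  `κ m ≤ ι m'` for `m < m'` (consecutive traversals may share a vertex);
* SEPARATED VERTEX TRAVERSALS: the same with `κ m < ι m'`.

Recorded: invariance / monotonicity of weak vertex traversals under shrinking the shell
(`vertexTraversals_mono`), lowering `k`, reversing the list (`vertexTraversals_reverse`), maps
scaling all distances to the centre (`vertexTraversals_of_map`), pointwise perturbation
(`vertexTraversals_of_forall₂`), adding points on either side (`vertexTraversals_append_right`,
`vertexTraversals_cons`), dropping a far-away prefix or suffix (`vertexTraversals_of_append_left`,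
`vertexTraversals_of_append_right`), and the extraction of `k` separated traversals from `2k` weak
ones (`sepVertexTraversals_of_two_mul`). The dictionary with the polyline itself is in
`PolylineShellTraversals.lean`. Sources: M. Aizenman, A. Burchard, Duke Math. J. 99 (1999) §1.b,
§3.a (discretisation of traversal counts); folklore. Deliberately NOT here: curves, lattices,
measures; no new definitions.
-/

open Set Metric

noncomputable section

namespace Literature.Probability.RandomPlanarGeometry

/-! ### Weak and separated vertex traversals of a list of points -/

section Discrete

variable {E F : Type*} [PseudoMetricSpace E] [PseudoMetricSpace F]
variable {l : List E} {k : ℕ} {x : E} {r R r' R' η : ℝ}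

/-- Shrinking the shell keeps weak vertex traversals. [folklore] -/
theorem vertexTraversals_mono
    (h : ∃ ι κ : Fin k → Fin l.length, (∀ m, ι m ≤ κ m) ∧
      (∀ m, (dist (l.get (ι m)) x ≤ r ∧ R ≤ dist (l.get (κ m)) x) ∨
        (R ≤ dist (l.get (ι m)) x ∧ dist (l.get (κ m)) x ≤ r)) ∧ ∀ ⦃m m'⦄, m < m' → κ m ≤ ι m')
    (hr : r ≤ r') (hR : R' ≤ R) :
    ∃ ι κ : Fin k → Fin l.length, (∀ m, ι m ≤ κ m) ∧
      (∀ m, (dist (l.get (ι m)) x ≤ r' ∧ R' ≤ dist (l.get (κ m)) x) ∨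
        (R' ≤ dist (l.get (ι m)) x ∧ dist (l.get (κ m)) x ≤ r')) ∧ ∀ ⦃m m'⦄, m < m' → κ m ≤ ι m' := by
  obtain ⟨ι, κ, h1, h2, h3⟩ := h
  refine ⟨ι, κ, h1, fun m => ?_, h3⟩
  rcases h2 m with h | h
  · exact Or.inl ⟨h.1.trans hr, hR.trans h.2⟩
  · exact Or.inr ⟨hR.trans h.1, h.2.trans hr⟩

/-- Fewer weak vertex traversals are easier. [folklore] -/
theorem vertexTraversals_of_le {j : ℕ}
    (h : ∃ ι κ : Fin k → Fin l.length, (∀ m, ι m ≤ κ m) ∧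
      (∀ m, (dist (l.get (ι m)) x ≤ r ∧ R ≤ dist (l.get (κ m)) x) ∨
        (R ≤ dist (l.get (ι m)) x ∧ dist (l.get (κ m)) x ≤ r)) ∧ ∀ ⦃m m'⦄, m < m' → κ m ≤ ι m')
    (hjk : j ≤ k) :
    ∃ ι κ : Fin j → Fin l.length, (∀ m, ι m ≤ κ m) ∧
      (∀ m, (dist (l.get (ι m)) x ≤ r ∧ R ≤ dist (l.get (κ m)) x) ∨
        (R ≤ dist (l.get (ι m)) x ∧ dist (l.get (κ m)) x ≤ r)) ∧ ∀ ⦃m m'⦄, m < m' → κ m ≤ ι m' := by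
  obtain ⟨ι, κ, h1, h2, h3⟩ := h
  refine ⟨ι ∘ Fin.castLE hjk, κ ∘ Fin.castLE hjk, fun m => h1 _, fun m => h2 _,
    fun m m' hmm' => h3 ?_⟩
  simpa using hmm'

/-- A positive number of weak vertex traversals forces a vertex in the inner ball. [folklore] -/
theorem exists_dist_le_of_vertexTraversals
    (h : ∃ ι κ : Fin k → Fin l.length, (∀ m, ι m ≤ κ m) ∧
      (∀ m, (dist (l.get (ι m)) x ≤ r ∧ R ≤ dist (l.get (κ m)) x) ∨
        (R ≤ dist (l.get (ι m)) x ∧ dist (l.get (κ m)) x ≤ r)) ∧ ∀ ⦃m m'⦄, m < m' → κ m ≤ ι m')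
    (hk : 0 < k) : ∃ p ∈ l, dist p x ≤ r := by
  obtain ⟨ι, κ, -, h2, -⟩ := h
  rcases h2 ⟨0, hk⟩ with h | h
  · exact ⟨_, List.get_mem _ _, h.1⟩
  · exact ⟨_, List.get_mem _ _, h.2⟩

/-- A list with a positive number of weak vertex traversals of a genuine shell has at least two
points. [folklore] -/
theorem two_le_length_of_vertexTraversals
    (h : ∃ ι κ : Fin k → Fin l.length, (∀ m, ι m ≤ κ m) ∧
      (∀ m, (dist (l.get (ι m)) x ≤ r ∧ R ≤ dist (l.get (κ m)) x) ∨
        (R ≤ dist (l.get (ι m)) x ∧ dist (l.get (κ m)) x ≤ r)) ∧ ∀ ⦃m m'⦄, m < m' → κ m ≤ ι m')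
    (hk : 0 < k) (hrR : r < R) : 2 ≤ l.length := by
  obtain ⟨ι, κ, h1, h2, -⟩ := h
  have hne : ι ⟨0, hk⟩ ≠ κ ⟨0, hk⟩ := by
    intro heq
    rcases h2 ⟨0, hk⟩ with h | h <;> rw [heq] at h <;> linarith [h.1, h.2]
  have hlt : ι ⟨0, hk⟩ < κ ⟨0, hk⟩ := lt_of_le_of_ne (h1 _) hne
  have := (κ ⟨0, hk⟩).isLt
  have hlt' : ((ι ⟨0, hk⟩ : ℕ)) < (κ ⟨0, hk⟩ : ℕ) := hlt
  omega

/-- Reversing the list keeps weak vertex traversals (read backwards). [folklore] -/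
theorem vertexTraversals_reverse
    (h : ∃ ι κ : Fin k → Fin l.length, (∀ m, ι m ≤ κ m) ∧
      (∀ m, (dist (l.get (ι m)) x ≤ r ∧ R ≤ dist (l.get (κ m)) x) ∨
        (R ≤ dist (l.get (ι m)) x ∧ dist (l.get (κ m)) x ≤ r)) ∧ ∀ ⦃m m'⦄, m < m' → κ m ≤ ι m') :
    ∃ ι κ : Fin k → Fin l.reverse.length, (∀ m, ι m ≤ κ m) ∧
      (∀ m, (dist (l.reverse.get (ι m)) x ≤ r ∧ R ≤ dist (l.reverse.get (κ m)) x) ∨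
        (R ≤ dist (l.reverse.get (ι m)) x ∧ dist (l.reverse.get (κ m)) x ≤ r)) ∧
      ∀ ⦃m m'⦄, m < m' → κ m ≤ ι m' := by
  obtain ⟨ι, κ, h1, h2, h3⟩ := h
  have hlen : l.reverse.length = l.length := List.length_reverse
  -- index reversal inside the list and order reversal of the traversals
  let ρ : Fin l.length → Fin l.reverse.length := fun i => (Fin.rev i).cast hlen.symm
  have hρ : ∀ i, l.reverse.get (ρ i) = l.get i := by
    intro i
    simp only [ρ, List.get_eq_getElem, Fin.val_cast, Fin.val_rev, List.getElem_reverse]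
    congr 1
    have := i.isLt
    omega
  have hρle : ∀ {i j : Fin l.length}, i ≤ j → ρ j ≤ ρ i := by
    intro i j hij
    change ((Fin.rev j : Fin l.length) : ℕ) ≤ (Fin.rev i : ℕ)
    rw [Fin.val_rev, Fin.val_rev]
    have : (i : ℕ) ≤ j := hij
    omega
  refine ⟨fun m => ρ (κ (Fin.rev m)), fun m => ρ (ι (Fin.rev m)), fun m => hρle (h1 _),
    fun m => ?_, fun m m' hmm' => hρle (h3 (Fin.rev_lt_rev.2 hmm'))⟩
  rw [hρ, hρ]
  rcases h2 (Fin.rev m) with h | h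
  · exact Or.inr ⟨h.2, h.1⟩
  · exact Or.inl ⟨h.2, h.1⟩

/-- Transport along a map multiplying all distances to the centre by `c > 0` (e.g. the
similarity `p ↦ δ p` of a normed space with `x' = δ x`): weak vertex traversals of `D(x'; r, R)`
by `l.map f` are weak vertex traversals of `D(x; r/c, R/c)` by `l`. [folklore] -/
theorem vertexTraversals_of_map {f : E → F} {x' : F} {c : ℝ} (hc : 0 < c)
    (hf : ∀ p, dist (f p) x' = c * dist p x)
    (h : ∃ ι κ : Fin k → Fin (l.map f).length, (∀ m, ι m ≤ κ m) ∧
      (∀ m, (dist ((l.map f).get (ι m)) x' ≤ r ∧ R ≤ dist ((l.map f).get (κ m)) x') ∨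
        (R ≤ dist ((l.map f).get (ι m)) x' ∧ dist ((l.map f).get (κ m)) x' ≤ r)) ∧
      ∀ ⦃m m'⦄, m < m' → κ m ≤ ι m') :
    ∃ ι κ : Fin k → Fin l.length, (∀ m, ι m ≤ κ m) ∧
      (∀ m, (dist (l.get (ι m)) x ≤ r / c ∧ R / c ≤ dist (l.get (κ m)) x) ∨
        (R / c ≤ dist (l.get (ι m)) x ∧ dist (l.get (κ m)) x ≤ r / c)) ∧
      ∀ ⦃m m'⦄, m < m' → κ m ≤ ι m' := by
  obtain ⟨ι, κ, h1, h2, h3⟩ := h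
  have hlen : (l.map f).length = l.length := List.length_map _
  refine ⟨fun m => (ι m).cast hlen, fun m => (κ m).cast hlen, fun m => h1 m, fun m => ?_,
    fun m m' hmm' => h3 hmm'⟩
  have := h2 m
  simp only [List.get_eq_getElem, List.getElem_map, hf] at this
  simp only [List.get_eq_getElem, Fin.val_cast]
  rcases this with h | h
  · exact Or.inl ⟨by rw [le_div_iff₀ hc]; linarith, by rw [div_le_iff₀ hc]; linarith⟩
  · exact Or.inr ⟨by rw [div_le_iff₀ hc]; linarith, by rw [le_div_iff₀ hc]; linarith⟩

/-- Pointwise perturbation by `≤ η` keeps weak vertex traversals of the shell shrunk by `η`.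
[folklore] -/
theorem vertexTraversals_of_forall₂ {l' : List E} (hll' : List.Forall₂ (fun p q => dist p q ≤ η) l l')
    (h : ∃ ι κ : Fin k → Fin l.length, (∀ m, ι m ≤ κ m) ∧
      (∀ m, (dist (l.get (ι m)) x ≤ r ∧ R ≤ dist (l.get (κ m)) x) ∨
        (R ≤ dist (l.get (ι m)) x ∧ dist (l.get (κ m)) x ≤ r)) ∧ ∀ ⦃m m'⦄, m < m' → κ m ≤ ι m') :
    ∃ ι κ : Fin k → Fin l'.length, (∀ m, ι m ≤ κ m) ∧
      (∀ m, (dist (l'.get (ι m)) x ≤ r + η ∧ R - η ≤ dist (l'.get (κ m)) x) ∨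
        (R - η ≤ dist (l'.get (ι m)) x ∧ dist (l'.get (κ m)) x ≤ r + η)) ∧
      ∀ ⦃m m'⦄, m < m' → κ m ≤ ι m' := by
  obtain ⟨ι, κ, h1, h2, h3⟩ := h
  have hlen : l.length = l'.length := hll'.length_eq
  refine ⟨fun m => (ι m).cast hlen, fun m => (κ m).cast hlen, fun m => h1 m, fun m => ?_,
    fun m m' hmm' => h3 hmm'⟩
  have hget : ∀ i : Fin l.length, dist (l.get i) (l'.get (i.cast hlen)) ≤ η := fun i => by
    simpa only [List.get_eq_getElem, Fin.val_cast] using hll'.get i.isLt (hlen ▸ i.isLt)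
  have hnear : ∀ i : Fin l.length, dist (l.get i) x ≤ r → dist (l'.get (i.cast hlen)) x ≤ r + η := by
    intro i hi
    have h1 := dist_triangle (l'.get (i.cast hlen)) (l.get i) x
    have h2 := dist_comm (l.get i) (l'.get (i.cast hlen))
    linarith [hget i]
  have hfar : ∀ i : Fin l.length, R ≤ dist (l.get i) x → R - η ≤ dist (l'.get (i.cast hlen)) x := by
    intro i hi
    have h1 := dist_triangle (l.get i) (l'.get (i.cast hlen)) x
    linarith [hget i]
  rcases h2 m with h | h
  · exact Or.inl ⟨hnear _ h.1, hfar _ h.2⟩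
  · exact Or.inr ⟨hfar _ h.1, hnear _ h.2⟩

/-- Appending points on the right keeps weak vertex traversals. [folklore] -/
theorem vertexTraversals_append_right
    (h : ∃ ι κ : Fin k → Fin l.length, (∀ m, ι m ≤ κ m) ∧
      (∀ m, (dist (l.get (ι m)) x ≤ r ∧ R ≤ dist (l.get (κ m)) x) ∨
        (R ≤ dist (l.get (ι m)) x ∧ dist (l.get (κ m)) x ≤ r)) ∧ ∀ ⦃m m'⦄, m < m' → κ m ≤ ι m')
    (l'' : List E) :
    ∃ ι κ : Fin k → Fin (l ++ l'').length, (∀ m, ι m ≤ κ m) ∧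
      (∀ m, (dist ((l ++ l'').get (ι m)) x ≤ r ∧ R ≤ dist ((l ++ l'').get (κ m)) x) ∨
        (R ≤ dist ((l ++ l'').get (ι m)) x ∧ dist ((l ++ l'').get (κ m)) x ≤ r)) ∧
      ∀ ⦃m m'⦄, m < m' → κ m ≤ ι m' := by
  obtain ⟨ι, κ, h1, h2, h3⟩ := h
  have hle : l.length ≤ (l ++ l'').length := by simp
  refine ⟨fun m => (ι m).castLE hle, fun m => (κ m).castLE hle, fun m => h1 m, fun m => ?_,
    fun m m' hmm' => h3 hmm'⟩
  have e : ∀ i : Fin l.length, (l ++ l'').get (i.castLE hle) = l.get i := fun i => by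
    simp only [List.get_eq_getElem, Fin.val_castLE]
    exact List.getElem_append_left i.isLt
  rw [e, e]
  exact h2 m

/-- Prepending a point keeps weak vertex traversals (indices shift by one). [folklore] -/
theorem vertexTraversals_cons
    (h : ∃ ι κ : Fin k → Fin l.length, (∀ m, ι m ≤ κ m) ∧
      (∀ m, (dist (l.get (ι m)) x ≤ r ∧ R ≤ dist (l.get (κ m)) x) ∨
        (R ≤ dist (l.get (ι m)) x ∧ dist (l.get (κ m)) x ≤ r)) ∧ ∀ ⦃m m'⦄, m < m' → κ m ≤ ι m')
    (p : E) :
    ∃ ι κ : Fin k → Fin (p :: l).length, (∀ m, ι m ≤ κ m) ∧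
      (∀ m, (dist ((p :: l).get (ι m)) x ≤ r ∧ R ≤ dist ((p :: l).get (κ m)) x) ∨
        (R ≤ dist ((p :: l).get (ι m)) x ∧ dist ((p :: l).get (κ m)) x ≤ r)) ∧
      ∀ ⦃m m'⦄, m < m' → κ m ≤ ι m' := by
  obtain ⟨ι, κ, h1, h2, h3⟩ := h
  refine ⟨fun m => (ι m).succ, fun m => (κ m).succ, fun m => Fin.succ_le_succ_iff.2 (h1 m),
    fun m => ?_, fun m m' hmm' => Fin.succ_le_succ_iff.2 (h3 hmm')⟩
  have e : ∀ i : Fin l.length, (p :: l).get i.succ = l.get i := fun i => by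
    simp only [List.get_eq_getElem, Fin.val_succ, List.getElem_cons_succ]
  rw [e, e]
  exact h2 m

/-- **Dropping a far-away prefix.** If no point of `l₁` lies in `B̄(x, r)` and the first point of
`l₂` is at distance `≥ R`, weak vertex traversals of `l₁ ++ l₂` give weak vertex traversals of `l₂`
(clip each index to the range of `l₂`). [folklore] -/
theorem vertexTraversals_of_append_left {l₁ l₂ : List E}
    (h : ∃ ι κ : Fin k → Fin (l₁ ++ l₂).length, (∀ m, ι m ≤ κ m) ∧
      (∀ m, (dist ((l₁ ++ l₂).get (ι m)) x ≤ r ∧ R ≤ dist ((l₁ ++ l₂).get (κ m)) x) ∨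
        (R ≤ dist ((l₁ ++ l₂).get (ι m)) x ∧ dist ((l₁ ++ l₂).get (κ m)) x ≤ r)) ∧
      ∀ ⦃m m'⦄, m < m' → κ m ≤ ι m')
    (h₁ : ∀ p ∈ l₁, r < dist p x) (hne : l₂ ≠ []) (hhead : R ≤ dist (l₂.head hne) x) :
    ∃ ι κ : Fin k → Fin l₂.length, (∀ m, ι m ≤ κ m) ∧
      (∀ m, (dist (l₂.get (ι m)) x ≤ r ∧ R ≤ dist (l₂.get (κ m)) x) ∨
        (R ≤ dist (l₂.get (ι m)) x ∧ dist (l₂.get (κ m)) x ≤ r)) ∧ ∀ ⦃m m'⦄, m < m' → κ m ≤ ι m' := by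
  obtain ⟨ι, κ, h1, h2, h3⟩ := h
  have hpos : 0 < l₂.length := List.length_pos_of_ne_nil hne
  -- clipping an index of `l₁ ++ l₂` to an index of `l₂`
  let cl : Fin (l₁ ++ l₂).length → Fin l₂.length := fun i =>
    ⟨i - l₁.length, by have := i.isLt; simp only [List.length_append] at this; omega⟩
  have hcl_mono : ∀ {i j : Fin (l₁ ++ l₂).length}, i ≤ j → cl i ≤ cl j := by
    intro i j hij
    change (i : ℕ) - l₁.length ≤ (j : ℕ) - l₁.length
    exact Nat.sub_le_sub_right hij _
  -- value after clipping: unchanged if the index was in `l₂`, the head of `l₂` otherwise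
  have hval1 : ∀ i : Fin (l₁ ++ l₂).length, l₁.length ≤ (i : ℕ) →
      l₂.get (cl i) = (l₁ ++ l₂).get i := by
    intro i hi
    simp only [cl, List.get_eq_getElem]
    rw [List.getElem_append_right hi]
  have hval2 : ∀ i : Fin (l₁ ++ l₂).length, (i : ℕ) < l₁.length → l₂.get (cl i) = l₂.head hne := by
    intro i hi
    simp only [cl, List.get_eq_getElem]
    rw [← List.getElem_zero_eq_head hpos]
    congr 1
    omega
  have hfar : ∀ i : Fin (l₁ ++ l₂).length, (i : ℕ) < l₁.length →
      r < dist ((l₁ ++ l₂).get i) x := by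
    intro i hi
    simp only [List.get_eq_getElem]
    rw [List.getElem_append_left hi]
    exact h₁ _ (List.getElem_mem hi)
  have hin : ∀ i : Fin (l₁ ++ l₂).length, dist ((l₁ ++ l₂).get i) x ≤ r → l₁.length ≤ (i : ℕ) := by
    intro i hi
    by_contra hlt
    exact absurd hi (not_le.2 (hfar i (not_le.1 hlt)))
  have hout : ∀ i : Fin (l₁ ++ l₂).length, R ≤ dist ((l₁ ++ l₂).get i) x →
      R ≤ dist (l₂.get (cl i)) x := by
    intro i hi
    by_cases hi2 : l₁.length ≤ (i : ℕ)
    · rw [hval1 i hi2]; exact hi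
    · rw [hval2 i (not_le.1 hi2)]; exact hhead
  refine ⟨fun m => cl (ι m), fun m => cl (κ m), fun m => hcl_mono (h1 m), fun m => ?_,
    fun m m' hmm' => hcl_mono (h3 hmm')⟩
  rcases h2 m with ⟨hi, hj⟩ | ⟨hi, hj⟩
  · refine Or.inl ⟨?_, hout _ hj⟩
    rw [hval1 _ (hin _ hi)]; exact hi
  · refine Or.inr ⟨hout _ hi, ?_⟩
    rw [hval1 _ (hin _ hj)]; exact hj

/-- **Dropping a far-away suffix** (the mirror image of `vertexTraversals_of_append_left`).
[folklore] -/
theorem vertexTraversals_of_append_right {l₂ l₃ : List E}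
    (h : ∃ ι κ : Fin k → Fin (l₂ ++ l₃).length, (∀ m, ι m ≤ κ m) ∧
      (∀ m, (dist ((l₂ ++ l₃).get (ι m)) x ≤ r ∧ R ≤ dist ((l₂ ++ l₃).get (κ m)) x) ∨
        (R ≤ dist ((l₂ ++ l₃).get (ι m)) x ∧ dist ((l₂ ++ l₃).get (κ m)) x ≤ r)) ∧
      ∀ ⦃m m'⦄, m < m' → κ m ≤ ι m')
    (h₃ : ∀ p ∈ l₃, r < dist p x) (hne : l₂ ≠ []) (hlast : R ≤ dist (l₂.getLast hne) x) :
    ∃ ι κ : Fin k → Fin l₂.length, (∀ m, ι m ≤ κ m) ∧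
      (∀ m, (dist (l₂.get (ι m)) x ≤ r ∧ R ≤ dist (l₂.get (κ m)) x) ∨
        (R ≤ dist (l₂.get (ι m)) x ∧ dist (l₂.get (κ m)) x ≤ r)) ∧ ∀ ⦃m m'⦄, m < m' → κ m ≤ ι m' := by
  have hrev := vertexTraversals_reverse h
  rw [List.reverse_append] at hrev
  have hne' : l₂.reverse ≠ [] := by simpa using hne
  have h' := vertexTraversals_of_append_left hrev (fun p hp => h₃ p (List.mem_reverse.1 hp)) hne'
    (by rwa [List.head_reverse])
  have h'' := vertexTraversals_reverse h'
  rwa [List.reverse_reverse] at h''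

/-- **Every other one of `2k` weak vertex traversals of a genuine shell: `k` separated vertex
traversals.** [folklore] -/
theorem sepVertexTraversals_of_two_mul
    (h : ∃ ι κ : Fin (2 * k) → Fin l.length, (∀ m, ι m ≤ κ m) ∧
      (∀ m, (dist (l.get (ι m)) x ≤ r ∧ R ≤ dist (l.get (κ m)) x) ∨
        (R ≤ dist (l.get (ι m)) x ∧ dist (l.get (κ m)) x ≤ r)) ∧ ∀ ⦃m m'⦄, m < m' → κ m ≤ ι m')
    (hrR : r < R) :
    ∃ ι κ : Fin k → Fin l.length, (∀ m, ι m ≤ κ m) ∧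
      (∀ m, (dist (l.get (ι m)) x ≤ r ∧ R ≤ dist (l.get (κ m)) x) ∨
        (R ≤ dist (l.get (ι m)) x ∧ dist (l.get (κ m)) x ≤ r)) ∧ ∀ ⦃m m'⦄, m < m' → κ m < ι m' := by
  obtain ⟨ι, κ, h1, h2, h3⟩ := h
  have hstrict : ∀ m, ι m < κ m := fun m =>
    lt_of_le_of_ne (h1 m) fun heq => by
      rcases h2 m with h | h <;> rw [heq] at h <;> linarith [h.1, h.2]
  let e : Fin k → Fin (2 * k) := fun m => ⟨2 * m, by omega⟩
  let e' : Fin k → Fin (2 * k) := fun m => ⟨2 * m + 1, by omega⟩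
  refine ⟨fun m => ι (e m), fun m => κ (e m), fun m => h1 _, fun m => h2 _, fun m m' hmm' => ?_⟩
  have hlt1 : e m < e' m := by change 2 * (m : ℕ) < 2 * m + 1; omega
  have hlt2 : e' m < e m' := by
    change 2 * (m : ℕ) + 1 < 2 * (m' : ℕ)
    have : (m : ℕ) < m' := hmm'
    omega
  calc κ (e m) ≤ ι (e' m) := h3 hlt1
    _ < κ (e' m) := hstrict _
    _ ≤ ι (e m') := h3 hlt2

/-- Fewer separated vertex traversals are easier. [folklore] -/
theorem sepVertexTraversals_of_le {j : ℕ}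
    (h : ∃ ι κ : Fin k → Fin l.length, (∀ m, ι m ≤ κ m) ∧
      (∀ m, (dist (l.get (ι m)) x ≤ r ∧ R ≤ dist (l.get (κ m)) x) ∨
        (R ≤ dist (l.get (ι m)) x ∧ dist (l.get (κ m)) x ≤ r)) ∧ ∀ ⦃m m'⦄, m < m' → κ m < ι m')
    (hjk : j ≤ k) :
    ∃ ι κ : Fin j → Fin l.length, (∀ m, ι m ≤ κ m) ∧
      (∀ m, (dist (l.get (ι m)) x ≤ r ∧ R ≤ dist (l.get (κ m)) x) ∨
        (R ≤ dist (l.get (ι m)) x ∧ dist (l.get (κ m)) x ≤ r)) ∧ ∀ ⦃m m'⦄, m < m' → κ m < ι m' := by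
  obtain ⟨ι, κ, h1, h2, h3⟩ := h
  refine ⟨ι ∘ Fin.castLE hjk, κ ∘ Fin.castLE hjk, fun m => h1 _, fun m => h2 _,
    fun m m' hmm' => h3 ?_⟩
  simpa using hmm'

/-- **Restriction to a middle piece.** If `l₁ ++ c ++ l₃` has `k` weak vertex traversals of
`D(x; r, R)`, no point of `l₁` or `l₃` lies in `B̄(x, r)`, and the first and last points of
`c ≠ []` are at distance `≥ R`, then `c` has `k` weak vertex traversals of `D(x; r, R)`.
[folklore] -/
theorem vertexTraversals_middle {l₁ c l₃ : List E} (hc : c ≠ [])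
    (h : ∃ ι κ : Fin k → Fin (l₁ ++ c ++ l₃).length, (∀ m, ι m ≤ κ m) ∧
      (∀ m, (dist ((l₁ ++ c ++ l₃).get (ι m)) x ≤ r ∧ R ≤ dist ((l₁ ++ c ++ l₃).get (κ m)) x) ∨
        (R ≤ dist ((l₁ ++ c ++ l₃).get (ι m)) x ∧ dist ((l₁ ++ c ++ l₃).get (κ m)) x ≤ r)) ∧
      ∀ ⦃m m'⦄, m < m' → κ m ≤ ι m')
    (h₁ : ∀ p ∈ l₁, r < dist p x) (h₃ : ∀ p ∈ l₃, r < dist p x) (hhead : R ≤ dist (c.head hc) x)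
    (hlast : R ≤ dist (c.getLast hc) x) :
    ∃ ι κ : Fin k → Fin c.length, (∀ m, ι m ≤ κ m) ∧
      (∀ m, (dist (c.get (ι m)) x ≤ r ∧ R ≤ dist (c.get (κ m)) x) ∨
        (R ≤ dist (c.get (ι m)) x ∧ dist (c.get (κ m)) x ≤ r)) ∧ ∀ ⦃m m'⦄, m < m' → κ m ≤ ι m' := by
  have hne : l₁ ++ c ≠ [] := by simp [hc]
  have h' := vertexTraversals_of_append_right h h₃ hne
    (by rwa [List.getLast_append_of_ne_nil _ hc])
  exact vertexTraversals_of_append_left h' h₁ hc hhead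

/-- Adding a point in front and a point at the end keeps weak vertex traversals (the two
"door" midpoints of a mid-edge arc). [folklore] -/
theorem vertexTraversals_cons_append_singleton {c : List E}
    (h : ∃ ι κ : Fin k → Fin c.length, (∀ m, ι m ≤ κ m) ∧
      (∀ m, (dist (c.get (ι m)) x ≤ r ∧ R ≤ dist (c.get (κ m)) x) ∨
        (R ≤ dist (c.get (ι m)) x ∧ dist (c.get (κ m)) x ≤ r)) ∧ ∀ ⦃m m'⦄, m < m' → κ m ≤ ι m')
    (p q : E) :
    ∃ ι κ : Fin k → Fin (p :: c ++ [q]).length, (∀ m, ι m ≤ κ m) ∧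
      (∀ m, (dist ((p :: c ++ [q]).get (ι m)) x ≤ r ∧ R ≤ dist ((p :: c ++ [q]).get (κ m)) x) ∨
        (R ≤ dist ((p :: c ++ [q]).get (ι m)) x ∧ dist ((p :: c ++ [q]).get (κ m)) x ≤ r)) ∧
      ∀ ⦃m m'⦄, m < m' → κ m ≤ ι m' :=
  vertexTraversals_append_right (vertexTraversals_cons h p) [q]

/-- Replacing the last point by an `η`-close one keeps weak vertex traversals of the shell shrunk
by `η ≥ 0`. [folklore] -/
theorem vertexTraversals_replace_last {c : List E} {p q : E} (hη : 0 ≤ η) (hpq : dist p q ≤ η)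
    (h : ∃ ι κ : Fin k → Fin (c ++ [p]).length, (∀ m, ι m ≤ κ m) ∧
      (∀ m, (dist ((c ++ [p]).get (ι m)) x ≤ r ∧ R ≤ dist ((c ++ [p]).get (κ m)) x) ∨
        (R ≤ dist ((c ++ [p]).get (ι m)) x ∧ dist ((c ++ [p]).get (κ m)) x ≤ r)) ∧
      ∀ ⦃m m'⦄, m < m' → κ m ≤ ι m') :
    ∃ ι κ : Fin k → Fin (c ++ [q]).length, (∀ m, ι m ≤ κ m) ∧
      (∀ m, (dist ((c ++ [q]).get (ι m)) x ≤ r + η ∧ R - η ≤ dist ((c ++ [q]).get (κ m)) x) ∨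
        (R - η ≤ dist ((c ++ [q]).get (ι m)) x ∧ dist ((c ++ [q]).get (κ m)) x ≤ r + η)) ∧
      ∀ ⦃m m'⦄, m < m' → κ m ≤ ι m' := by
  refine vertexTraversals_of_forall₂ (List.rel_append ?_ ?_) h
  · exact List.forall₂_same.2 fun y _ => by simpa using hη
  · exact List.Forall₂.cons hpq List.Forall₂.nil

end Discrete

end Literature.Probability.RandomPlanarGeometry

end

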